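import Literature.Combinatorics.Digraph.LineDigraphArborescencesNoSources
import HarnessLib

/-!
# Iterated line digraphs: Levine's Theorem 4.1, `κ(Lⁿ G) = κ(G) ∏_v outdeg(v)^{p(n,v) − 1}`

Topic `Literature/Combinatorics/Digraph`, namespace `Literature.Combinatorics.Digraph.Multidigraph`.
Lane `lit-hodgefound`, seat p23, generation 46, row g46-#15 of the programme «The spectrum of the arc
digraph and de Bruijn's count `2^{2^{n−1}−n}`» (iterating `LineDigraphArborescencesNoSources`, Levine's
(2) as printed).

## Source, verbatim

L. Levine, *Sandpile groups and spanning trees of directed line graphs*, J. Combin. Theory Ser. A 118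
(2011) 350–364 [Levine2011], §4 «Iterated line graphs» (held text `paper:arxiv-0906.2809`, chunk p0010):
«Let `G = (V, E)` be a finite directed graph, loops and multiple edges allowed. The iterated line digraph
`Lⁿ G = (E_n, E_{n+1})` has as vertices the set
`E_n = {(e_1, …, e_n) ∈ Eⁿ | s(e_{i+1}) = t(e_i), i = 1, …, n − 1}` of directed paths of `n` edges in `G`.
The edge set of `Lⁿ G` is `E_{n+1}`, and the incidence is defined by `s(e_1, …, e_{n+1}) = (e_1, …, e_n)`;
`t(e_1, …, e_{n+1}) = (e_2, …, e_{n+1})`. (We also set `E_0 = V`, and `L⁰ G = G`.) […] Given a vertex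
`v ∈ V`, let `p(n, v) = #{(e_1, …, e_n) ∈ E_n | t(e_n) = v}` be the number of directed paths of `n` edges
in `G` ending at vertex `v`. **Theorem 4.1.** Let `G = (V, E)` be a finite directed graph with no
sources. Then `κ(Lⁿ G) = κ(G) ∏_{v ∈ V} outdeg(v)^{p(n,v) − 1}`. *Proof.* For any `j ≥ 0`, by Theorem 1.1
applied to `L^j G` with all edge weights `1`,
`κ(L^{j+1} G) / κ(L^j G) = ∏_{(e_1,…,e_j) ∈ E_j} outdeg(t(e_j))^{indeg(s(e_1)) − 1} = ∏_{v ∈ V} outdeg(v)^{p(j+1,v) − p(j,v)}`.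
Taking the product over `j = 0, …, n − 1` yields the result. □ When `G` is balanced `k`-regular, we have
`p(n, v) = kⁿ` for all vertices `v`, so we obtain as a special case of Theorem 4.1 the result of Huaxiao,
Fuji and Qiongxiang: `κ(Lⁿ G) = κ(G) k^{(kⁿ − 1) #V}`.»

## What is here (definitions with bodies, theorems; no named fact, no instance, no notation)

* §1 `IsPath p` (a tuple `p : Fin (k+1) → A` of composable arcs: a directed path of `k + 1` edges),
  closure under `Fin.init`, `Fin.tail`, `Fin.snoc`, `Fin.cons`; **`pathDigraph G k`** — Levine's
  `L^{k+1} G = (E_{k+1}, E_{k+2})` (vertices the paths of `k + 1` edges, arcs those of `k + 2`, source = the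
  first `k + 1` edges, target = the last `k + 1`); `numPaths G k v` = `p(k+1, v)`.
* §2 `pathDigraphZeroIso : L¹ G ≅ G*` (the arc digraph `lineDigraph`) and
  **`pathDigraphSuccIso : L^{k+2} G ≅ (L^{k+1} G)*`** — the iteration.
* §3 degrees: `inDeg_pathDigraph` (`= indeg(s(e_1))`), `outDeg_pathDigraph` (`= outdeg(t(e_{k+1}))`);
  `numPaths_zero` (`p(1, v) = indeg v`), **`numPaths_succ`** (`p(k+2, v) = Σ_{paths to v} indeg(s(e_1))`),
  `numPaths_le_numPaths_succ`.
* §4 **`sum_card_arborescencesTo_pathDigraph`** — THEOREM 4.1: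
  `κ(L^{k+1} G) = κ(G) ∏_v outdeg(v)^{p(k+1, v) − 1}` for every finite directed multigraph without
  sources, every `k`; `numPaths_of_inRegular` (`p(n, v) = rⁿ` when all in-degrees are `r`) and
  **`sum_card_arborescencesTo_pathDigraph_of_regular`** — Huaxiao–Fuji–Qiongxiang's
  `κ(Lⁿ G) = κ(G) k^{(kⁿ − 1) #V}` for balanced `k`-regular `G`.

## References

* [Levine2011] L. Levine, *Sandpile groups and spanning trees of directed line graphs*, J. Combin.
  Theory Ser. A 118 (2011) 350–364, §4, Theorem 4.1.
* Tree: `Digraph/LineDigraphArborescencesNoSources` (`sum_card_arborescencesTo_lineDigraph_noSources`),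
  `Digraph/MultidigraphAdjacencyMatrix` (`Iso.card_arborescencesTo_eq`), `Digraph/MultidigraphLineDigraph`
  (`Iso`, `lineDigraph`, the pattern of `deBruijnArcEquiv`).
-/

namespace Literature.Combinatorics.Digraph

namespace Multidigraph

open Finset

variable {V A : Type*} (G : Multidigraph V A)

/-! ### §1 Directed paths and the iterated line digraph -/

section Paths

/-- **A directed path of `k + 1` edges** `(e_1, …, e_{k+1})`: `s(e_{i+1}) = t(e_i)` (an `abbrev`, so that
the paths form a `Fintype` by the decidability of the finitely many conditions).
[cite: Levine2011, §4 («`E_n = {(e_1, …, e_n) ∈ Eⁿ | s(e_{i+1}) = t(e_i)}`»)] -/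
abbrev IsPath {k : ℕ} (p : Fin (k + 1) → A) : Prop :=
  ∀ i : Fin k, G.src (p i.succ) = G.tgt (p (Fin.castSucc i))

variable {G}

/-- A single edge is a path («`E_1 = E`»). [cite: Levine2011, §4] -/
theorem isPath_zero (p : Fin 1 → A) : G.IsPath p := fun i => i.elim0

/-- The first `k + 1` edges of a path. [cite: Levine2011, §4 («`s(e_1, …, e_{n+1}) = (e_1, …, e_n)`»)] -/
theorem IsPath.init {k : ℕ} {p : Fin (k + 2) → A} (hp : G.IsPath p) : G.IsPath (Fin.init p) :=
  fun i => hp (Fin.castSucc i)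

/-- The last `k + 1` edges of a path. [cite: Levine2011, §4 («`t(e_1, …, e_{n+1}) = (e_2, …, e_{n+1})`»)] -/
theorem IsPath.tail {k : ℕ} {p : Fin (k + 2) → A} (hp : G.IsPath p) : G.IsPath (Fin.tail p) :=
  fun i => hp i.succ

/-- Appending a composable edge at the end. [cite: Levine2011, §4] -/
theorem IsPath.snoc {k : ℕ} {p : Fin (k + 1) → A} (hp : G.IsPath p) {a : A}
    (ha : G.src a = G.tgt (p (Fin.last k))) : G.IsPath (Fin.snoc p a : Fin (k + 2) → A) := by
  intro i
  refine Fin.lastCases ?_ (fun j => ?_) i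
  · rw [Fin.succ_last, Fin.snoc_last, Fin.snoc_castSucc]
    exact ha
  · rw [Fin.succ_castSucc, Fin.snoc_castSucc, Fin.snoc_castSucc]
    exact hp j

/-- Prepending a composable edge. [cite: Levine2011, §4] -/
theorem IsPath.cons {k : ℕ} {p : Fin (k + 1) → A} (hp : G.IsPath p) {a : A}
    (ha : G.tgt a = G.src (p 0)) : G.IsPath (Fin.cons a p : Fin (k + 2) → A) := by
  intro i
  refine Fin.cases ?_ (fun j => ?_) i
  · rw [Fin.cons_succ, Fin.castSucc_zero, Fin.cons_zero]
    exact ha.symm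
  · rw [Fin.cons_succ, ← Fin.succ_castSucc, Fin.cons_succ]
    exact hp j

variable (G)

/-- **The iterated line digraph `L^{k+1} G = (E_{k+1}, E_{k+2})`**: vertices the directed paths of
`k + 1` edges, arcs the paths of `k + 2` edges, `s(e_1, …, e_{k+2}) = (e_1, …, e_{k+1})`,
`t(e_1, …, e_{k+2}) = (e_2, …, e_{k+2})` (Levine's `Lⁿ G` for `n = k + 1`; `L⁰ G = G` itself).
[cite: Levine2011, §4] -/
def pathDigraph (k : ℕ) :
    Multidigraph {p : Fin (k + 1) → A // G.IsPath p} {q : Fin (k + 2) → A // G.IsPath q} :=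
  ⟨fun q => ⟨Fin.init q.1, q.2.init⟩, fun q => ⟨Fin.tail q.1, q.2.tail⟩⟩

/-- [cite: Levine2011, §4] -/
@[simp] theorem pathDigraph_src (k : ℕ) (q : {q : Fin (k + 2) → A // G.IsPath q}) :
    (G.pathDigraph k).src q = ⟨Fin.init q.1, q.2.init⟩ := rfl

/-- [cite: Levine2011, §4] -/
@[simp] theorem pathDigraph_tgt (k : ℕ) (q : {q : Fin (k + 2) → A // G.IsPath q}) :
    (G.pathDigraph k).tgt q = ⟨Fin.tail q.1, q.2.tail⟩ := rfl

variable [Fintype A] [DecidableEq V]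

/-- **`p(k+1, v)`**: the number of directed paths of `k + 1` edges ending at the vertex `v`.
[cite: Levine2011, §4 («`p(n, v) = #{(e_1, …, e_n) ∈ E_n | t(e_n) = v}`»)] -/
def numPaths (k : ℕ) (v : V) : ℕ :=
  (univ.filter fun p : {p : Fin (k + 1) → A // G.IsPath p} => G.tgt (p.1 (Fin.last k)) = v).card

/-- [cite: Levine2011, §4] -/
theorem numPaths_def (k : ℕ) (v : V) : G.numPaths k v =
    (univ.filter fun p : {p : Fin (k + 1) → A // G.IsPath p} => G.tgt (p.1 (Fin.last k)) = v).card :=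
  rfl

end Paths

/-! ### §2 `L¹ G ≅ G*` and `L^{k+2} G ≅ (L^{k+1} G)*` -/

section Isos

/-- The one-edge paths are the edges. [cite: Levine2011, §4 («`E_1 = E`, `L¹ G = LG`»)] -/
def pathVertexZeroEquiv : {p : Fin 1 → A // G.IsPath p} ≃ A where
  toFun p := p.1 0
  invFun a := ⟨fun _ => a, isPath_zero _⟩
  left_inv p := Subtype.ext (funext fun i => by
    show p.1 0 = p.1 i
    rw [Subsingleton.elim i 0])
  right_inv _ := rfl

/-- The two-edge paths are the composable pairs of edges (the arcs of the arc digraph `G*`).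
[cite: Levine2011, §4] -/
def pathArcZeroEquiv : {q : Fin 2 → A // G.IsPath q} ≃ {pp : A × A // G.tgt pp.1 = G.src pp.2} where
  toFun q := ⟨(q.1 0, q.1 1), (q.2 0).symm⟩
  invFun pp := ⟨![pp.1.1, pp.1.2], fun i => by
    fin_cases i
    exact pp.2.symm⟩
  left_inv q := Subtype.ext (funext fun i => by fin_cases i <;> rfl)
  right_inv _ := rfl

/-- **`L¹ G ≅ G*`**: Levine's `L¹ G = (E_1, E_2)` is the arc digraph `lineDigraph G`.
[cite: Levine2011, §4] -/
def pathDigraphZeroIso : Iso (G.pathDigraph 0) G.lineDigraph where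
  vertexEquiv := G.pathVertexZeroEquiv
  arcEquiv := G.pathArcZeroEquiv
  src_comm _ := rfl
  tgt_comm _ := rfl

/-- The paths of `k + 3` edges are the composable pairs of paths of `k + 2` edges (the pattern of
gen-45's `deBruijnArcEquiv`). [cite: Levine2011, §4] -/
def pathArcSuccEquiv (k : ℕ) :
    {q : Fin (k + 3) → A // G.IsPath q} ≃
      {pp : {p : Fin (k + 2) → A // G.IsPath p} × {p : Fin (k + 2) → A // G.IsPath p} //
        (G.pathDigraph k).tgt pp.1 = (G.pathDigraph k).src pp.2} where
  toFun q := ⟨(⟨Fin.init q.1, q.2.init⟩, ⟨Fin.tail q.1, q.2.tail⟩), Subtype.ext (funext fun _ => rfl)⟩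
  invFun pp := ⟨Fin.snoc pp.1.1.1 (pp.1.2.1 (Fin.last (k + 1))), pp.1.1.2.snoc (by
    have h : pp.1.1.1 (Fin.last (k + 1)) = pp.1.2.1 (Fin.castSucc (Fin.last k)) :=
      congrFun (congrArg Subtype.val pp.2) (Fin.last k)
    rw [h, ← Fin.succ_last]
    exact pp.1.2.2 (Fin.last k))⟩
  left_inv q := by
    apply Subtype.ext
    have h : (Fin.tail q.1) (Fin.last (k + 1)) = q.1 (Fin.last (k + 2)) := rfl
    simp only
    rw [h, Fin.snoc_init_self]
  right_inv pp := by
    obtain ⟨⟨⟨a, ha⟩, ⟨b, hb⟩⟩, hab⟩ := pp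
    have hab' : Fin.tail a = Fin.init b := congrArg Subtype.val hab
    apply Subtype.ext
    simp only [Prod.mk.injEq]
    refine ⟨Subtype.ext (by
      show Fin.init (Fin.snoc (α := fun _ => A) a (b (Fin.last (k + 1)))) = a
      exact Fin.init_snoc _ _), Subtype.ext ?_⟩
    funext i
    refine Fin.lastCases ?_ (fun j => ?_) i
    · show Fin.snoc (α := fun _ => A) a (b (Fin.last (k + 1))) (Fin.last (k + 1)).succ = b (Fin.last (k + 1))
      rw [Fin.succ_last, Fin.snoc_last]
    · show Fin.snoc (α := fun _ => A) a (b (Fin.last (k + 1))) (Fin.castSucc j).succ = b (Fin.castSucc j)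
      rw [Fin.succ_castSucc, Fin.snoc_castSucc]
      exact congrFun hab' j

/-- **`L^{k+2} G ≅ (L^{k+1} G)*`**: the iteration `L^{n+1} G = L(Lⁿ G)` (vertices literally equal, arcs by
`pathArcSuccEquiv`). [cite: Levine2011, §4] -/
def pathDigraphSuccIso (k : ℕ) : Iso (G.pathDigraph (k + 1)) (G.pathDigraph k).lineDigraph where
  vertexEquiv := Equiv.refl _
  arcEquiv := G.pathArcSuccEquiv k
  src_comm _ := rfl
  tgt_comm _ := rfl

end Isos

/-! ### §3 Degrees in `L^{k+1} G` and the path counts `p(n, v)` -/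

section Degrees

variable [Fintype A] [DecidableEq V] [DecidableEq A]

/-- **`indeg_{L^{k+1} G}(e_1, …, e_{k+1}) = indeg_G(s(e_1))`** (prepend an edge).
[cite: Levine2011, §4 (proof of Thm. 4.1)] -/
theorem inDeg_pathDigraph (k : ℕ) (p : {p : Fin (k + 1) → A // G.IsPath p}) :
    (G.pathDigraph k).inDeg p = G.inDeg (G.src (p.1 0)) := by
  rw [inDeg, inDeg]
  refine Finset.card_bij (fun q _ => q.1 0) (fun q hq => ?_) (fun q₁ hq₁ q₂ hq₂ h => ?_) (fun a ha => ?_)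
  · rw [mem_inArcs] at hq ⊢
    have h1 : q.1 1 = p.1 0 := by
      rw [← hq]
      rfl
    rw [← h1]
    exact (q.2 0).symm
  · apply Subtype.ext
    rw [mem_inArcs] at hq₁ hq₂
    have t1 : Fin.tail q₁.1 = p.1 := congrArg Subtype.val hq₁
    have t2 : Fin.tail q₂.1 = p.1 := congrArg Subtype.val hq₂
    rw [← Fin.cons_self_tail q₁.1, ← Fin.cons_self_tail q₂.1, t1, t2, h]
  · rw [mem_inArcs] at ha
    refine ⟨⟨Fin.cons a p.1, p.2.cons ha⟩, ?_, rfl⟩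
    rw [mem_inArcs]
    exact Subtype.ext (by
      show Fin.tail (Fin.cons (α := fun _ => A) a p.1) = p.1
      exact Fin.tail_cons _ _)

/-- **`outdeg_{L^{k+1} G}(e_1, …, e_{k+1}) = outdeg_G(t(e_{k+1}))`** (append an edge).
[cite: Levine2011, §4 (proof of Thm. 4.1)] -/
theorem outDeg_pathDigraph (k : ℕ) (p : {p : Fin (k + 1) → A // G.IsPath p}) :
    (G.pathDigraph k).outDeg p = G.outDeg (G.tgt (p.1 (Fin.last k))) := by
  rw [outDeg, outDeg]
  refine Finset.card_bij (fun q _ => q.1 (Fin.last (k + 1))) (fun q hq => ?_)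
    (fun q₁ hq₁ q₂ hq₂ h => ?_) (fun a ha => ?_)
  · rw [mem_outArcs] at hq ⊢
    have h1 : q.1 (Fin.castSucc (Fin.last k)) = p.1 (Fin.last k) := by
      rw [← hq]
      rfl
    rw [← h1, ← Fin.succ_last]
    exact q.2 (Fin.last k)
  · apply Subtype.ext
    rw [mem_outArcs] at hq₁ hq₂
    have t1 : Fin.init q₁.1 = p.1 := congrArg Subtype.val hq₁
    have t2 : Fin.init q₂.1 = p.1 := congrArg Subtype.val hq₂
    rw [← Fin.snoc_init_self q₁.1, ← Fin.snoc_init_self q₂.1, t1, t2, h]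
  · rw [mem_outArcs] at ha
    refine ⟨⟨Fin.snoc p.1 a, p.2.snoc ha⟩, ?_, by
      show Fin.snoc (α := fun _ => A) p.1 a (Fin.last (k + 1)) = a
      exact Fin.snoc_last _ _⟩
    rw [mem_outArcs]
    exact Subtype.ext (by
      show Fin.init (Fin.snoc (α := fun _ => A) p.1 a) = p.1
      exact Fin.init_snoc _ _)

omit [DecidableEq A] in
/-- `p(1, v) = indeg(v)`. [cite: Levine2011, §4] -/
theorem numPaths_zero (v : V) : G.numPaths 0 v = G.inDeg v := by
  rw [numPaths, inDeg]
  refine Finset.card_bij (fun p _ => p.1 0) (fun p hp => ?_) (fun p₁ _ p₂ _ h => ?_) (fun a ha => ?_)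
  · rw [mem_inArcs]
    exact (Finset.mem_filter.1 hp).2
  · exact G.pathVertexZeroEquiv.injective h
  · refine ⟨⟨fun _ => a, isPath_zero _⟩, ?_, rfl⟩
    rw [Finset.mem_filter]
    exact ⟨mem_univ _, mem_inArcs.1 ha⟩

/-- **`p(k+2, v) = Σ_{(e_1, …, e_{k+1}) → v} indeg(s(e_1))`** (the in-degrees of `L^{k+1} G` summed over
the paths ending at `v`). [cite: Levine2011, §4 (proof of Thm. 4.1: `Σ p(j+1, v) − p(j, v)`)] -/
theorem numPaths_succ (k : ℕ) (v : V) :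
    G.numPaths (k + 1) v =
      ∑ p ∈ univ.filter (fun p : {p : Fin (k + 1) → A // G.IsPath p} => G.tgt (p.1 (Fin.last k)) = v),
        G.inDeg (G.src (p.1 0)) := by
  rw [numPaths, Finset.card_eq_sum_card_fiberwise (f := (G.pathDigraph k).tgt)
    (t := univ.filter fun p : {p : Fin (k + 1) → A // G.IsPath p} => G.tgt (p.1 (Fin.last k)) = v)
    (fun q hq => by simpa [Fin.tail, Fin.succ_last] using hq)]
  refine Finset.sum_congr rfl fun p hp => ?_
  rw [← inDeg_pathDigraph, inDeg]
  congr 1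
  ext q
  simp only [Finset.mem_filter, Finset.mem_univ, true_and, mem_inArcs]
  constructor
  · exact fun h => h.2
  · intro h
    refine ⟨?_, h⟩
    have hp' := (Finset.mem_filter.1 hp).2
    rw [← h] at hp'
    exact hp'

/-- `p(k+1, v) ≤ p(k+2, v)` when `G` has no sources (every path extends backwards).
[cite: Levine2011, §4] -/
theorem numPaths_le_numPaths_succ (hin : ∀ v, 0 < G.inDeg v) (k : ℕ) (v : V) :
    G.numPaths k v ≤ G.numPaths (k + 1) v := by
  rw [numPaths_succ, numPaths, Finset.card_eq_sum_ones]
  exact Finset.sum_le_sum fun p _ => hin _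

/-- Exponent bookkeeping: `(|s| − 1) + Σ_{i ∈ s} (f i − 1) = (Σ_{i ∈ s} f i) − 1` when all `f i ≥ 1`.
[cite: Levine2011, §4 (proof of Thm. 4.1: «Taking the product over `j = 0, …, n − 1`»)] -/
theorem card_sub_one_add_sum_sub_one {ι : Type*} [DecidableEq ι] (s : Finset ι) (f : ι → ℕ)
    (hf : ∀ i ∈ s, 1 ≤ f i) : (s.card - 1) + ∑ i ∈ s, (f i - 1) = (∑ i ∈ s, f i) - 1 := by
  induction s using Finset.induction_on with
  | empty => simp
  | insert a s has ih =>
    have h1 := hf a (Finset.mem_insert_self a s)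
    have h2 := ih fun i hi => hf i (Finset.mem_insert_of_mem hi)
    have h3 : s.card ≤ ∑ i ∈ s, f i := by
      rw [Finset.card_eq_sum_ones]
      exact Finset.sum_le_sum fun i hi => hf i (Finset.mem_insert_of_mem hi)
    have h4 : s.card = 0 → ∑ i ∈ s, f i = 0 := fun h => by
      rw [Finset.card_eq_zero.1 h, Finset.sum_empty]
    rw [Finset.card_insert_of_notMem has, Finset.sum_insert has, Finset.sum_insert has]
    generalize (∑ x ∈ s, (f x - 1)) = X at h2 ⊢
    generalize (∑ x ∈ s, f x) = Y at h2 h3 h4 ⊢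
    omega

end Degrees

/-! ### §4 Theorem 4.1 -/

section Theorem

variable [Fintype V] [DecidableEq V] [Fintype A] [DecidableEq A]

/-- **Theorem 4.1** («Let `G = (V, E)` be a finite directed graph with no sources. Then
`κ(Lⁿ G) = κ(G) ∏_{v ∈ V} outdeg(v)^{p(n,v) − 1}`»), for `n = k + 1`, with `κ(·) = Σ_roots t⁻(·, root)`
the number of oriented spanning trees: Levine's telescoping induction — `L^{k+2} G ≅ (L^{k+1} G)*`,
Theorem 1.1 ∕ (2) for `L^{k+1} G` (which has no sources), and the regrouping
`∏_{(e_1,…,e_{k+1})} outdeg(t(e_{k+1}))^{indeg(s(e_1)) − 1} = ∏_v outdeg(v)^{p(k+2,v) − p(k+1,v)}`.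
[cite: Levine2011, §4, Thm. 4.1] -/
theorem sum_card_arborescencesTo_pathDigraph (hin : ∀ v, 0 < G.inDeg v) (k : ℕ) :
    ∑ p, ((G.pathDigraph k).arborescencesTo p).card =
      (∑ v, (G.arborescencesTo v).card) * ∏ v, G.outDeg v ^ (G.numPaths k v - 1) := by
  induction k with
  | zero =>
    have hiso : ∑ p, ((G.pathDigraph 0).arborescencesTo p).card =
        ∑ a, (G.lineDigraph.arborescencesTo a).card := by
      rw [← G.pathVertexZeroEquiv.sum_comp (fun a => (G.lineDigraph.arborescencesTo a).card)]
      exact Finset.sum_congr rfl fun p _ => (G.pathDigraphZeroIso.card_arborescencesTo_eq p).symm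
    rw [hiso, G.sum_card_arborescencesTo_lineDigraph_noSources hin]
    simp_rw [numPaths_zero]
  | succ k ih =>
    have hiso : ∑ p, ((G.pathDigraph (k + 1)).arborescencesTo p).card =
        ∑ p, ((G.pathDigraph k).lineDigraph.arborescencesTo p).card :=
      Finset.sum_congr rfl fun p _ => ((G.pathDigraphSuccIso k).card_arborescencesTo_eq p).symm
    rw [hiso, (G.pathDigraph k).sum_card_arborescencesTo_lineDigraph_noSources
      (fun p => by rw [inDeg_pathDigraph]; exact hin _), ih, mul_assoc]
    congr 1
    simp_rw [inDeg_pathDigraph, outDeg_pathDigraph]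
    rw [← Finset.prod_fiberwise_of_maps_to (s := (univ : Finset {p : Fin (k + 1) → A // G.IsPath p}))
      (t := (univ : Finset V)) (g := fun p => G.tgt (p.1 (Fin.last k))) (fun _ _ => mem_univ _),
      ← Finset.prod_mul_distrib]
    refine Finset.prod_congr rfl fun v _ => ?_
    rw [Finset.prod_congr rfl fun p (hp : p ∈ univ.filter fun p : {p : Fin (k + 1) → A // G.IsPath p} =>
        G.tgt (p.1 (Fin.last k)) = v) => by rw [(Finset.mem_filter.1 hp).2],
      Finset.prod_pow_eq_pow_sum, ← pow_add]
    congr 1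
    rw [numPaths_succ, numPaths]
    exact card_sub_one_add_sum_sub_one _ _ fun p _ => hin _

omit [Fintype V] in
/-- In-regular digraphs: `p(n, v) = rⁿ`. [cite: Levine2011, §4 («When `G` is balanced `k`-regular, we
have `p(n, v) = kⁿ`»)] -/
theorem numPaths_of_inRegular {r : ℕ} (hreg : ∀ v, G.inDeg v = r) (k : ℕ) (v : V) :
    G.numPaths k v = r ^ (k + 1) := by
  induction k with
  | zero => rw [numPaths_zero, hreg, zero_add, pow_one]
  | succ k ih =>
    rw [numPaths_succ, Finset.sum_congr rfl fun p _ => hreg _, Finset.sum_const, smul_eq_mul,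
      ← numPaths_def, ih, ← pow_succ]

/-- **Huaxiao–Fuji–Qiongxiang: `κ(Lⁿ G) = κ(G) k^{(kⁿ − 1) #V}`** for a `k`-regular directed multigraph
(`indeg = outdeg = r ≥ 1` at every vertex), `n = m + 1`. [cite: Levine2011, §4 (after Thm. 4.1)] -/
theorem sum_card_arborescencesTo_pathDigraph_of_regular {r : ℕ} (hr : 0 < r)
    (hin : ∀ v, G.inDeg v = r) (hout : ∀ v, G.outDeg v = r) (m : ℕ) :
    ∑ p, ((G.pathDigraph m).arborescencesTo p).card =
      (∑ v, (G.arborescencesTo v).card) * r ^ ((r ^ (m + 1) - 1) * Fintype.card V) := by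
  rw [G.sum_card_arborescencesTo_pathDigraph (fun v => by rw [hin v]; exact hr) m]
  simp_rw [hout, G.numPaths_of_inRegular hin]
  rw [Finset.prod_const, Finset.card_univ, ← pow_mul]

end Theorem

end Multidigraph

end Literature.Combinatorics.Digraph
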